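import Summits.CriticalPhenomena.PercolationContinuityZ3.Theorems.Transplant.SkelPhiParaRunFrame
import Summits.CriticalPhenomena.PercolationContinuityZ3.Theorems.Transplant.SkelPhiEquilibriumWDefs
import HarnessLib

/-!
# N1 (the `{±1}` node), LEVEL 1: the landing bridges of `SkelPhiParaRunFrame` for the LINK-SCALE pieces of the design fix S-1′ (`pgSideHalfW` /
# `pgTopPieceW`, `SkelPhiEquilibriumWDefs`, p3-g8 2026-08-21T12:40Z) — same statements and proofs as `landing_runX` / `landing_runY`, membership read
# through `mem_pgSideHalfW` / `mem_pgTopPieceW` (the planar constraints `|α| ≤ n`, `|β′| ≤ nℓ` now come from the `pgramCyl n h ℓ` conjunct)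

builds on p205010 (kernel theorem, internal audit signed; external expert review pending) — nothing in this file uses p205010; nothing here is a
claim about the open node `SamePDropOfSkeletonNeg`.
Lane `prim-bschramm`, seat `prim-bschramm-p1` (gen 11); helper file (`--supports stmt-CriticalPhenomena-4575 --as helper`).
* **`landing_runX_W`** (`w ∈ pgSideHalfW t n h ℓ R σ τ` ⇒ along offset `= n`, floored signed transverse offset in the piece of sign `στ` of `xPrmW`);
* **`landing_runY_W`** (`w ∈ pgTopPieceW t n h ℓ R σ τ v` ⇒ along offset in `[sLo, sHi]` of `yPrmW`, transverse offset `σα − v` in the piece of sign `τ`).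
[cite: MartineauTassion2017, §3.2 Lemma 3.5 (the pieces), §4.3 Lemma 4.2]
-/

noncomputable section

namespace Summit.CriticalPhenomena.PercolationContinuityZ3.Theorems.Transplant

namespace Skelφ

open Literature.Probability.Percolation Literature.Probability.LatticeModels SimpleGraph

variable {V : Type} {G : SimpleGraph V} {φ : V → Site 2}

/-- **Landing of an x-stride, link-scale pieces (S-1′)**: a vertex of `pgSideHalfW t n h ℓ R σ τ` (the run's own sign `σ`) has along offset EXACTLY `n` and floored signed
transverse offset in the piece of sign `στ` of `xPrmW`. [cite: MartineauTassion2017, §3.2 Lemma 3.5 (L(a,u), L(u,b)), §4.3 Lemma 4.2] -/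
theorem landing_runX_W [G.LocallyFinite] {n : ℕ} (hn : 1 ≤ n) (c₀ : V) (h : ℤ) {σ τ : ℤ} (hσ : σ = 1 ∨ σ = -1) (hτ : τ = 1 ∨ τ = -1) {t w : V} {ℓ R : ℕ}
    (hw : w ∈ pgSideHalfW G φ t n h ℓ R σ τ) (R' q N : ℕ) :
    runX φ c₀ n h σ w 0 - runX φ c₀ n h σ t 0 = n ∧
      (xPrmW n ℓ h R' q N).InPiece (σ * τ) (runX φ c₀ n h σ w 1 - runX φ c₀ n h σ t 1 - (xPrmW n ℓ h R' q N).d) := by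
  have hσσ : σ * σ = 1 := by rcases hσ with rfl | rfl <;> simp
  obtain ⟨-, hC, hα, hτβ⟩ := (mem_pgSideHalfW G φ).1 hw
  obtain ⟨-, hβ⟩ := (mem_pgramCyl (φ := φ)).1 hC
  have hc := shearUnit_pos hn h
  refine ⟨by rw [runX_sub_runX_zero, hα, ← mul_assoc, hσσ, one_mul], ?_⟩
  rw [abs_le] at hβ
  have hd : (xPrmW n ℓ h R' q N).d = 0 := rfl
  have hPp : (xPrmW n ℓ h R' q N).Pp = n * ℓ / shearUnit n h + 1 := rfl
  have hPm : (xPrmW n ℓ h R' q N).Pm = n * ℓ / shearUnit n h + 1 := rfl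
  rw [ChainPara.RunPrm.InPiece, hd, sub_zero, hPp, hPm]
  push_cast
  -- `(−nℓ)/c ≥ −(nℓ/c) − 1`
  have hneg : -((n : ℤ) * ℓ / (shearUnit n h : ℕ)) - 1 ≤ -((n : ℤ) * ℓ) / (shearUnit n h : ℕ) := by
    have h2 := ediv_sub_ediv_le_add_one (x := 0) (y := -((n : ℤ) * ℓ)) (b := (n : ℤ) * ℓ) hc (by simp)
    rw [Int.zero_ediv, zero_sub] at h2
    linarith
  constructor
  · intro hστ
    -- `στ = 1`: `τ = σ`, `0 ≤ σβ′ ≤ nℓ`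
    have hτσ : τ = σ := by
      rcases hσ with rfl | rfl <;> rcases hτ with rfl | rfl <;> first | rfl | norm_num at hστ
    rw [hτσ] at hτβ
    have h1 : σ * shearCoord φ t n h w ≤ (n : ℤ) * ℓ := by
      rcases hσ with rfl | rfl <;> linarith [hβ.1, hβ.2]
    obtain ⟨ha, hb⟩ := runX_sub_runX_one_bounds hn φ c₀ h σ t w hτβ h1
    rw [Int.zero_ediv] at ha
    exact ⟨ha, hb⟩
  · intro hστ
    -- `στ = −1`: `τ = −σ`, `−nℓ ≤ σβ′ ≤ 0`
    have hτσ : τ = -σ := by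
      rcases hσ with rfl | rfl <;> rcases hτ with rfl | rfl <;> first | rfl | norm_num at hστ
    rw [hτσ] at hτβ
    have h1 : σ * shearCoord φ t n h w ≤ 0 := by rw [neg_mul] at hτβ; linarith
    have h0 : -((n : ℤ) * ℓ) ≤ σ * shearCoord φ t n h w := by
      rcases hσ with rfl | rfl <;> linarith [hβ.1, hβ.2]
    obtain ⟨ha, -⟩ := runX_sub_runX_one_bounds hn φ c₀ h σ t w h0 h1
    -- the upper bound `≤ 0` by monotonicity of the floor (the generic bound is loose by one here)
    have hb : runX φ c₀ n h σ w 1 - runX φ c₀ n h σ t 1 ≤ 0 := by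
      rw [runX_one, runX_one]
      have e : σ * shearCoord φ c₀ n h w - σ * shearCoord φ c₀ n h t = σ * shearCoord φ t n h w := by
        rw [shearCoord_sub_origin φ c₀ t n h w]; ring
      have hmono := Int.ediv_le_ediv hc (show σ * shearCoord φ c₀ n h w ≤ σ * shearCoord φ c₀ n h t by linarith)
      linarith
    exact ⟨by linarith, hb⟩

/-- **Landing of a y′-stride, link-scale pieces (S-1′)**: a vertex of `pgTopPieceW t n h ℓ R σ τ v` (the run's own sign `σ`) has floored along offset in `[sLo, sHi]` of `yPrmW` and
transverse offset `σα − v` in the piece of sign `τ`. [cite: MartineauTassion2017, §3.2 Lemma 3.5 (L(v,b), L(−a,v)), §4.3 Lemma 4.2] -/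
theorem landing_runY_W [G.LocallyFinite] {n : ℕ} (hn : 1 ≤ n) (c₀ : V) (h : ℤ) {σ τ : ℤ} (hσ : σ = 1 ∨ σ = -1) (hτ : τ = 1 ∨ τ = -1) {t w : V} {ℓ R : ℕ} {v : ℤ}
    (hw : w ∈ pgTopPieceW G φ t n h ℓ R σ τ v) (R' q N : ℕ) :
    ((yPrmW n ℓ h v R' q N).sLo ≤ runY φ c₀ n h σ w 0 - runY φ c₀ n h σ t 0 ∧
        runY φ c₀ n h σ w 0 - runY φ c₀ n h σ t 0 ≤ (yPrmW n ℓ h v R' q N).sHi) ∧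
      (yPrmW n ℓ h v R' q N).InPiece τ (runY φ c₀ n h σ w 1 - runY φ c₀ n h σ t 1 - (yPrmW n ℓ h v R' q N).d) := by
  have hσ1 : |σ| = 1 := by rcases hσ with rfl | rfl <;> simp
  obtain ⟨-, hC, hlay, hτα⟩ := (mem_pgTopPieceW G φ).1 hw
  obtain ⟨hα, hβ⟩ := (mem_pgramCyl (φ := φ)).1 hC
  have hc := shearUnit_pos hn h
  rw [abs_le] at hβ hα
  refine ⟨?_, ?_⟩
  · -- along: `nℓ − c < σβ′ ≤ nℓ`
    have h1 : σ * shearCoord φ t n h w ≤ (n : ℤ) * ℓ := by rcases hσ with rfl | rfl <;> linarith [hβ.1, hβ.2]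
    have h0 : (n : ℤ) * ℓ - (shearUnit n h : ℕ) + 1 ≤ σ * shearCoord φ t n h w := by
      unfold shearUnit; linarith
    obtain ⟨ha, hb⟩ := runY_sub_runY_zero_bounds hn φ c₀ h σ t w h0 h1
    simp only [yPrmW]
    exact ⟨ha, hb⟩
  · -- transverse: `σα − v ∈ [0, n − v]` or `[−(n+v), 0]`
    rw [runY_sub_runY_one]
    simp only [yPrmW, ChainPara.RunPrm.InPiece]
    have hσα : -(n : ℤ) ≤ σ * relCoord φ t 0 w ∧ σ * relCoord φ t 0 w ≤ n := by
      rcases hσ with rfl | rfl <;> constructor <;> linarith [hα.1, hα.2]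
    constructor
    · intro hτ1; subst hτ1
      rw [one_mul] at hτα
      have hnv : ((n - v).toNat : ℤ) = n - v := Int.toNat_of_nonneg (by linarith [hσα.2])
      rw [hnv]; constructor <;> linarith [hσα.2]
    · intro hτ1; subst hτ1
      have hnv : ((n + v).toNat : ℤ) = n + v := Int.toNat_of_nonneg (by linarith [hσα.1])
      rw [hnv]; constructor <;> linarith [hσα.1]


end Skelφ

end Summit.CriticalPhenomena.PercolationContinuityZ3.Theorems.Transplant

end
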